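import Literature.AnabelianGeometry.EtaleTheta.Discharge.Sec5Lem59vTransport

/-!
# [EtTh] §5 ← Lemma 5.9 (iv): a theta cocycle of the class DIES on `Ker ρ ∩ Π^tp_Ÿ̲` — the binder `hdies` from the bi-theta isomorphism (proof-only)

Mochizuki, *The étale theta function and its Frobenioid-theoretic manifestations*, Publ. RIMS **45** (2009),
Lemma 5.9 (iv)/(v) p.332 (PDF p.106), Prop. 5.2 (iii) p.324 (PDF p.98), p.47 («conjugation by an element of `μ_N`
corresponds precisely to modifying a cocycle by a coboundary») [cite: MochizukiEtTh2009, Lem 5.9 (iv) p.332 (PDF p.106)].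
abc-iut cell, layer L2, seat abc-iut-w4-d042 (gen 2); PROOF-ONLY (0 definitions, 0 named facts), sequel of
`Sec5Lem59vTransport.lean` (p417589) and `Sec5Rho219PinLaws.lean` (p420275/p420661: the `Δ`-part).

THE POINT.  The Prop. 5.5 / Thm. 5.6 (i) chain of abc-iut-w5-d123 (`Sec5Prop55EtaTautological.lean`,
`ThetaEnvData.exists_descent_thetaCocycle`) takes the binder `hdies : ∀ k ∈ Π^tp_Ÿ, ρ k = 1 → η₀ k = 1` («the mod-`N`
theta cocycle dies on `Ker ρ ∩ Π^tp_Ÿ̲`: `B_N` is an `l·N`-codomain», GAP-LEDGER G-w5d123-1; shape studied by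
abc-iut-L6-t23, `Sec5RootCocycleDiesOnBN.lean`).  Here it is DERIVED, in its honest «some cocycle of the class» form,
from the bi-theta isomorphism `i : E^Π_N ⥲ Π^tp_Y[μ_N]` of Lemma 5.9 (iv) lying over an identification `ι` (abc-iut-L2-t4's
`EnvIsoBiTheta` data, discharged by abc-iut-L2-t11 modulo its named dictionary hypotheses):
* `exists_biThetaIso_sCapPi_eq_conj` / `exists_biThetaIso_sCupPi_eq_conj` — there are `c, c′ ∈ μ_N` with
  `i(s^⊓-Π_N(y)) = μ(c) s^alg(ι y) μ(c)⁻¹` and `i(s^⊔-Π_N(y)) = μ(c′) s^Θ_η(ι y) μ(c′)⁻¹` for ALL `y ∈ Π^tp_Ÿ̲` (the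
  `map_sAlg` / `map_sTheta` clauses of the isomorphism + «`i` lies over `ι`»);
* `biThetaIso_biKummer_eq_one_of_rho_eq_one` — for `ρ y = 1` the bi-Kummer difference `s^⊓-Π_N(y) · s^⊔-Π_N(y)⁻¹`
  is `μ(s^⊓-gp_N(1) · s^⊔-gp_N(1)⁻¹) = 1`;
* `ThetaEnvData.eta_eq_coboundary_of_conj_eq` — envelope algebra (p.47): `μ(c) s^alg(g) μ(c)⁻¹ = μ(c′) s^Θ_η(g) μ(c′)⁻¹`
  forces `η(g) = δ_{c′c⁻¹}(g)` (the coboundary of `c′c⁻¹`);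
* `exists_coboundary_eta_eq_of_rho_eq_one` — hence `η = δ_d` ON `ι(Ker ρ ∩ Π^tp_Ÿ̲)` for one `d ∈ μ_N`;
* `exists_thetaCocycle_dies_of_biTheta` — so `η₀ := η · δ_{d⁻¹}` (a cocycle of the class, `mul_coboundary_mem`) DIES on
  `ι(Ker ρ ∩ Π^tp_Ÿ̲)`: **the binder `hdies` (for `ρ ∘ ι⁻¹` on `Π^tp_Ÿ`) holds for some cocycle of the collection** —
  exactly the input of w5-d123's `exists_descent_thetaCocycle` / `exists_eta_etaTautological_ofBiKummerData`.
HONEST FRAMING: a RE-ROUTING of G-w5d123-1 to the inputs of Lemma 5.9 (iv) (`EnvIsoBiTheta`-type data: the isomorphism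
`i` for ONE cocycle `η`, lying over `ι`, with `ι(Π^tp_Ÿ̲) = Π^tp_Ÿ`), not an unconditional discharge; the cocycle that
dies is `η` modified by a coboundary (over `Δ` it is `η` itself: `Sec5Rho219PinLaws`); [EtTh] refereed; no side taken on
[IUTchIII] Cor. 3.12; typed ≠ proved.
-/

noncomputable section

namespace Literature.AnabelianGeometry.EtaleTheta

open CategoryTheory
open FrobenioidCyclotomicRigidity

universe w v v' u u'

/-! ## Envelope algebra: comparing the `μ_N`-conjugates of the two sections (p.47) -/

namespace ThetaEnvData

variable {N : ℕ+} (T : ThetaEnvData.{u} N)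

/-- **`μ(c) s^alg(g) μ(c)⁻¹ = μ(c′) s^Θ_η(g) μ(c′)⁻¹` forces `η(g) = δ_{c′c⁻¹}(g)`** — «conjugation by an element of
`μ_N` corresponds precisely to modifying a cocycle by a coboundary» (p.47): the `μ_N`-components read
`δ_c(g) = η(g)⁻¹ δ_{c′}(g)`. [cite: MochizukiEtTh2009, p.47; Def 2.13 (i) p.47] -/
theorem eta_eq_coboundary_of_conj_eq {η : T.PiYdd → T.mu} (hη : η ∈ T.thetaCocycles) (c c' : T.mu) (g : T.PiYdd)
    (h : CycEnvelope.inMu T.augY T.chi c * T.sAlg g * (CycEnvelope.inMu T.augY T.chi c)⁻¹ =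
      CycEnvelope.inMu T.augY T.chi c' * T.sTheta hη g * (CycEnvelope.inMu T.augY T.chi c')⁻¹) :
    η g = CycEnvelope.coboundary (T.aug.comp T.PiYdd.subtype) T.chi (c' * c⁻¹) g := by
  have hc := CycEnvelope.conj_inMu_eq_shift_coboundary T.augY T.chi c (T.sAlg g)
  have hc' := CycEnvelope.conj_inMu_eq_shift_coboundary T.augY T.chi c' (T.sTheta hη g)
  rw [MulAut.conj_apply] at hc hc'
  rw [hc, hc'] at h
  have hl := congrArg SemidirectProduct.left h
  simp only [CycEnvelope.shift, MulEquiv.coe_mk, Equiv.coe_fn_mk, ThetaEnvData.sAlg, ThetaEnvData.sTheta,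
    MonoidHom.coe_comp, Function.comp_apply, SemidirectProduct.left_inr, one_mul, MonoidHom.coe_mk,
    OneHom.coe_mk, SemidirectProduct.right_inr] at hl
  -- `hl : δ_c(g) = η(g)⁻¹ · δ_{c′}(g)` (as functions on `Π^tp_Y`, evaluated at `inclYdd g`)
  have key : η g = CycEnvelope.coboundary T.augY T.chi c' (T.inclYdd g) *
      (CycEnvelope.coboundary T.augY T.chi c (T.inclYdd g))⁻¹ := by
    rw [hl, mul_inv_rev, inv_inv, mul_inv_cancel_left]
  rw [key]
  simp only [CycEnvelope.coboundary, MonoidHom.coe_comp, Function.comp_apply, map_mul, map_inv, mul_inv_rev,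
    inv_inv]
  change c' * ((T.chi (T.aug (g : T.PiX))) c')⁻¹ * ((T.chi (T.aug (g : T.PiX))) c * c⁻¹) =
    c' * c⁻¹ * ((T.chi (T.aug (g : T.PiX))) c * ((T.chi (T.aug (g : T.PiX))) c')⁻¹)
  simp only [mul_assoc, mul_comm, mul_left_comm]

/-- A coboundary-twist of a theta cocycle evaluated: `(η · δ_{d⁻¹})(g) = η(g) · δ_d(g)⁻¹`.
[cite: MochizukiEtTh2009, p.47] -/
theorem mul_coboundary_inv_apply (η : T.PiYdd → T.mu) (d : T.mu) (g : T.PiYdd) :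
    (η * CycEnvelope.coboundary (T.aug.comp T.PiYdd.subtype) T.chi d⁻¹) g =
      η g * (CycEnvelope.coboundary (T.aug.comp T.PiYdd.subtype) T.chi d g)⁻¹ := by
  simp only [Pi.mul_apply, CycEnvelope.coboundary, map_inv, inv_inv, mul_inv_rev]
  rw [mul_comm ((T.chi _) d) d⁻¹]

end ThetaEnvData

/-! ## The two sections under the bi-theta isomorphism, for ALL of `Π^tp_Ÿ̲` (conjugators exposed) -/

namespace ThetaFrobenioid

variable {C : Type u} [Category.{v} C] {D : Type u'} [Category.{v'} D] (𝔉 : ThetaFrobenioid.{w} C D)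
  (h1 : 𝔉.SectionsFactor) (h3 : 𝔉.OuterActionLZ) (hsec : 𝔉.SgpCapSection) (hcs : 𝔉.SgpCupSection)
  (h8 : 𝔉.ConstantsEqNormalizer) (DK : Set (TopOut 𝔉.EPiN))
  {N : ℕ+} (T : ThetaEnvData.{v} N) (ι : 𝔉.PiX ≃ₜ* T.PiX)
  {η : T.PiYdd → T.mu} (hη : η ∈ T.thetaCocycles)
  (i : (𝔉.frdBiThetaEnv h1 h3 hsec hcs h8 DK).Iso (T.modelBi hη))

/-- **`i(s^⊓-Π_N(y)) = μ(c) s^alg_Ÿ(ι y) μ(c)⁻¹` for ONE `c ∈ μ_N` and ALL `y ∈ Π^tp_Ÿ̲`**: the `map_sAlg` clause gives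
`i(Im s^⊓-Π_N) = μ(c) Im(s^alg) μ(c)⁻¹`, and the conjugate of `s^alg(y′)` that `i(s^⊓-Π_N(y))` is lies over `ι y`, so
`y′ = ι y`. [cite: MochizukiEtTh2009, Lem 5.9 (iv) p.332 (PDF p.106)] -/
theorem exists_biThetaIso_sCapPi_eq_conj
    (hi : ∀ x : 𝔉.EPiN, ((CycEnvelope.proj T.augY T.chi (i.e x) : T.PiY) : T.PiX) = ι (𝔉.toPiY x))
    (hYdd : 𝔉.PiYdd.map ι.toMonoidHom = T.PiYdd) :
    ∃ c : T.mu, ∀ y : 𝔉.PiYdd, i.e (𝔉.sCapPi hsec y) =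
      CycEnvelope.inMu T.augY T.chi c * T.sAlg ⟨ι (y : 𝔉.PiX), 𝔉.iota_mem_PiYdd T ι hYdd y⟩ *
        (CycEnvelope.inMu T.augY T.chi c)⁻¹ := by
  obtain ⟨c, hc⟩ := 𝔉.exists_map_range_sCapPi_eq h1 h3 hsec hcs h8 DK T hη i
  refine ⟨c, fun y => ?_⟩
  have hmem : i.e (𝔉.sCapPi hsec y) ∈ (𝔉.sCapPi hsec).range.map i.e.toMulEquiv.toMonoidHom :=
    ⟨𝔉.sCapPi hsec y, ⟨y, rfl⟩, rfl⟩
  rw [hc, CycEnvelope.mem_map_conj_inMu_iff] at hmem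
  obtain ⟨_, ⟨y', rfl⟩, hyy'⟩ := hmem
  have hproj : ((CycEnvelope.proj T.augY T.chi (T.sAlg y') : T.PiY) : T.PiX) = ι (y : 𝔉.PiX) := by
    have h := hi (𝔉.sCapPi hsec y)
    rw [hyy', map_mul, map_mul, map_inv, 𝔉.toPiY_sCapPi hsec] at h
    simpa using h
  have hy' : y' = ⟨ι (y : 𝔉.PiX), 𝔉.iota_mem_PiYdd T ι hYdd y⟩ := Subtype.ext hproj
  subst hy'
  exact hyy'

/-- **`i(s^⊔-Π_N(y)) = μ(c′) s^Θ_η(ι y) μ(c′)⁻¹` for ONE `c′ ∈ μ_N` and ALL `y ∈ Π^tp_Ÿ̲`** (`map_sTheta`, likewise).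
[cite: MochizukiEtTh2009, Lem 5.9 (iv) p.332 (PDF p.106)] -/
theorem exists_biThetaIso_sCupPi_eq_conj
    (hi : ∀ x : 𝔉.EPiN, ((CycEnvelope.proj T.augY T.chi (i.e x) : T.PiY) : T.PiX) = ι (𝔉.toPiY x))
    (hYdd : 𝔉.PiYdd.map ι.toMonoidHom = T.PiYdd) :
    ∃ c' : T.mu, ∀ y : 𝔉.PiYdd, i.e (𝔉.sCupPi h1 hcs y) =
      CycEnvelope.inMu T.augY T.chi c' * T.sTheta hη ⟨ι (y : 𝔉.PiX), 𝔉.iota_mem_PiYdd T ι hYdd y⟩ *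
        (CycEnvelope.inMu T.augY T.chi c')⁻¹ := by
  obtain ⟨c, hc⟩ := 𝔉.exists_map_range_sCupPi_eq h1 h3 hsec hcs h8 DK T hη i
  refine ⟨c, fun y => ?_⟩
  have hmem : i.e (𝔉.sCupPi h1 hcs y) ∈ (𝔉.sCupPi h1 hcs).range.map i.e.toMulEquiv.toMonoidHom :=
    ⟨𝔉.sCupPi h1 hcs y, ⟨y, rfl⟩, rfl⟩
  rw [hc, CycEnvelope.mem_map_conj_inMu_iff] at hmem
  obtain ⟨_, ⟨y', rfl⟩, hyy'⟩ := hmem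
  have hproj : (y' : T.PiX) = ι (y : 𝔉.PiX) := by
    have h := hi (𝔉.sCupPi h1 hcs y)
    rw [hyy', map_mul, map_mul, map_inv, 𝔉.toPiY_sCupPi h1 hcs, T.proj_sTheta] at h
    simpa using h
  have hy' : y' = ⟨ι (y : 𝔉.PiX), 𝔉.iota_mem_PiYdd T ι hYdd y⟩ := Subtype.ext hproj
  subst hy'
  exact hyy'

/-- **On `Ker ρ ∩ Π^tp_Ÿ̲` the bi-Kummer difference is trivial**: for `ρ y = 1`,
`s^⊓-Π_N(y) · s^⊔-Π_N(y)⁻¹ = μ(s^⊓-gp_N(1) · s^⊔-gp_N(1)⁻¹) = 1` in `E^Π_N`, hence so is its image under `i`.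
[cite: MochizukiEtTh2009, Prop 4.3 (iii) p.317 (PDF p.91); Lem 5.9 (iv) p.332 (PDF p.106)] -/
theorem biThetaIso_biKummer_eq_one_of_rho_eq_one (y : 𝔉.PiYdd) (hρ : 𝔉.ρ (y : 𝔉.PiX) = 1) :
    i.e (𝔉.sCapPi hsec y * (𝔉.sCupPi h1 hcs y)⁻¹) = 1 := by
  have hcap : 𝔉.sgpCap (𝔉.ρ (y : 𝔉.PiX)) = 1 := by rw [hρ, map_one]
  have hcup : 𝔉.sgpCup (𝔉.rhoYdd y) = 1 := by
    have hYdd1 : 𝔉.rhoYdd y = 1 := Subtype.ext hρ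
    rw [hYdd1]
    exact map_one _
  obtain ⟨u, hu⟩ := 𝔉.sCapPi_mul_sCupPi_inv_mem_range_muIncl h1 hsec hcs y
  have hfst := congrArg Prod.fst (congrArg (fun e : 𝔉.EPiN => (e : Aut 𝔉.BN × 𝔉.PiX)) hu)
  rw [coe_muIncl, coe_sCapPi_mul_sCupPi_inv_fst] at hfst
  change (u : Aut 𝔉.BN) = 𝔉.sgpCap (𝔉.ρ (y : 𝔉.PiX)) * (𝔉.sgpCup (𝔉.rhoYdd y))⁻¹ at hfst
  rw [hcap, hcup, inv_one, mul_one] at hfst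
  have hu1 : u = 1 := Subtype.ext hfst
  rw [← hu, hu1, map_one]
  exact map_one i.e

/-- **`η` is a COBOUNDARY on `ι(Ker ρ ∩ Π^tp_Ÿ̲)`**: there is `d ∈ μ_N` with `η(ι y) = δ_d(ι y)` whenever `y ∈ Π^tp_Ÿ̲`,
`ρ y = 1` — from `1 = i(s^⊓-Π_N(y) s^⊔-Π_N(y)⁻¹) = μ(c) s^alg(ι y) μ(c)⁻¹ · (μ(c′) s^Θ_η(ι y) μ(c′)⁻¹)⁻¹` and the
envelope algebra, `d = c′c⁻¹`. [cite: MochizukiEtTh2009, Lem 5.9 (iv)/(v) p.332 (PDF p.106); p.47] -/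
theorem exists_coboundary_eta_eq_of_rho_eq_one
    (hi : ∀ x : 𝔉.EPiN, ((CycEnvelope.proj T.augY T.chi (i.e x) : T.PiY) : T.PiX) = ι (𝔉.toPiY x))
    (hYdd : 𝔉.PiYdd.map ι.toMonoidHom = T.PiYdd) :
    ∃ d : T.mu, ∀ (y : 𝔉.PiYdd), 𝔉.ρ (y : 𝔉.PiX) = 1 →
      η ⟨ι (y : 𝔉.PiX), 𝔉.iota_mem_PiYdd T ι hYdd y⟩ =
        CycEnvelope.coboundary (T.aug.comp T.PiYdd.subtype) T.chi d ⟨ι (y : 𝔉.PiX), 𝔉.iota_mem_PiYdd T ι hYdd y⟩ := by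
  obtain ⟨c, hc⟩ := 𝔉.exists_biThetaIso_sCapPi_eq_conj h1 h3 hsec hcs h8 DK T ι hη i hi hYdd
  obtain ⟨c', hc'⟩ := 𝔉.exists_biThetaIso_sCupPi_eq_conj h1 h3 hsec hcs h8 DK T ι hη i hi hYdd
  refine ⟨c' * c⁻¹, fun y hρ => ?_⟩
  have h := 𝔉.biThetaIso_biKummer_eq_one_of_rho_eq_one h1 h3 hsec hcs h8 DK T hη i y hρ
  rw [𝔉.biThetaIso_map_mul_inv h1 h3 hsec hcs h8 DK T hη i, hc y, hc' y, mul_inv_eq_one] at h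
  exact T.eta_eq_coboundary_of_conj_eq hη c c' _ h

/-- **The binder `hdies` from Lemma 5.9 (iv)** (GAP-LEDGER G-w5d123-1, «some cocycle of the class» form): given the
bi-theta isomorphism `i` lying over `ι` (for one theta cocycle `η`), there is a theta cocycle `η₀` OF THE COLLECTION
(`η₀ = η · δ_{d⁻¹}`, `mul_coboundary_mem`) that DIES on `ι(Ker ρ ∩ Π^tp_Ÿ̲)`: `∀ k ∈ Π^tp_Ÿ, ρ(ι⁻¹ k) = 1 → η₀ k = 1`
— the hypothesis `hdies` of abc-iut-w5-d123's `ThetaEnvData.exists_descent_thetaCocycle` for `ρ ∘ ι⁻¹`.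
[cite: MochizukiEtTh2009, Lem 5.9 (iv)/(v) p.332 (PDF p.106); Prop 5.2 (iii) p.324 (PDF p.98)] -/
theorem exists_thetaCocycle_dies_of_biTheta
    (hi : ∀ x : 𝔉.EPiN, ((CycEnvelope.proj T.augY T.chi (i.e x) : T.PiY) : T.PiX) = ι (𝔉.toPiY x))
    (hYdd : 𝔉.PiYdd.map ι.toMonoidHom = T.PiYdd) :
    ∃ η₀ ∈ T.thetaCocycles, ∀ k : T.PiYdd, 𝔉.ρ (ι.symm (k : T.PiX)) = 1 → η₀ k = 1 := by
  obtain ⟨d, hd⟩ := 𝔉.exists_coboundary_eta_eq_of_rho_eq_one h1 h3 hsec hcs h8 DK T ι hη i hi hYdd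
  refine ⟨η * CycEnvelope.coboundary (T.aug.comp T.PiYdd.subtype) T.chi d⁻¹, T.mul_coboundary_mem η hη d⁻¹,
    fun k hk => ?_⟩
  -- pull `k` back along `ι`: `k = ι y` with `y ∈ Π^tp_Ÿ̲`
  have hkmem : (k : T.PiX) ∈ 𝔉.PiYdd.map ι.toMonoidHom := by rw [hYdd]; exact k.2
  obtain ⟨y, hy, hyk⟩ := hkmem
  have hys : ι.symm (k : T.PiX) = y := by rw [← hyk]; exact ι.symm_apply_apply y
  rw [hys] at hk
  have hk' : k = ⟨ι ((⟨y, hy⟩ : 𝔉.PiYdd) : 𝔉.PiX), 𝔉.iota_mem_PiYdd T ι hYdd ⟨y, hy⟩⟩ := Subtype.ext hyk.symm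
  rw [T.mul_coboundary_inv_apply, hk', hd ⟨y, hy⟩ hk, mul_inv_cancel]

/-! ## `Ker ρ ∩ Π^tp_Ÿ̲` acts TRIVIALLY on `μ_N` (the binder `hD1`, G-L6t23-1) — and `η` dies there ON THE NOSE

(appended, abc-iut-w4-d042 gen 2.)  For `y ∈ Π^tp_Ÿ̲` with `ρ y = 1`, `s^⊓-Π_N(y) = (s^⊓-gp_N(1), y) = (1, y)` commutes with
every `(u, 1) ∈ μ_N(B_N)` inside `E^Π_N ⊆ Aut_C(B_N) × Π^tp_X̲`; under the bi-theta isomorphism (which carries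
`μ_N(B_N)` ONTO the cyclotome `μ_N ⊆ Π^tp_Y[μ_N]`, lying over `ι`) this says that `ι y` centralises the cyclotome,
i.e. `χ(aug(ι y)) = 1` — abc-iut-L6-t23's binder `hD1` (GAP G-L6t23-1) for `ρ ∘ ι⁻¹`.  Consequently every coboundary
vanishes on `ι(Ker ρ ∩ Π^tp_Ÿ̲)`, and `exists_coboundary_eta_eq_of_rho_eq_one` upgrades to: **`η` ITSELF dies on
`ι(Ker ρ ∩ Π^tp_Ÿ̲)`** — abc-iut-w5-d123's `hdies` VERBATIM for the cocycle `η` of the isomorphism. -/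

/-- Conjugation in the cyclotomic envelope acts on the cyclotome through the character:
`x · μ(a) · x⁻¹ = μ(χ(aug(x̄)) a)`, `x̄ = x.right` the image of `x` in `Π` (`μ_N` is abelian).
[cite: MochizukiEtTh2009, Def 2.10 p.44; p.47] -/
theorem _root_.Literature.AnabelianGeometry.EtaleTheta.CycEnvelope.conj_inMu_eq
    {P G μ : Type*} [Group P] [Group G] [CommGroup μ] (aug : P →* G) (χ : G →* MulAut μ)
    (x : CycEnvelope aug χ) (a : μ) :
    x * CycEnvelope.inMu aug χ a * x⁻¹ = CycEnvelope.inMu aug χ (χ (aug x.right) a) := by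
  ext
  · simp only [SemidirectProduct.mul_left, SemidirectProduct.inv_left, SemidirectProduct.left_inl,
      SemidirectProduct.mul_right, SemidirectProduct.right_inl, mul_one, MonoidHom.coe_comp, Function.comp_apply,
      map_inv, MulAut.apply_inv_self]
    exact mul_inv_cancel_comm _ _
  · simp

/-- **`hD1` from Lemma 5.9 (iv): `Ker ρ ∩ Π^tp_Ÿ̲` acts trivially on `μ_N`.**  For `y ∈ Π^tp_Ÿ̲` with `ρ y = 1`:
`χ(aug(ι y)) = 1` — `s^⊓-Π_N(y) = (1, y)` centralises `μ_N(B_N) ⊆ E^Π_N`, the isomorphism carries `μ_N(B_N)` onto the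
cyclotome (lying over `ι`), and conjugation there is the character (`CycEnvelope.conj_inMu_eq`).  This is
abc-iut-L6-t23's binder `hD1` (GAP G-L6t23-1, `Sec5RootCocycleDiesOnBN`) for `ρ ∘ ι⁻¹`, at ANY §5 datum admitting the
isomorphism of (iv). [cite: MochizukiEtTh2009, Lem 5.9 (iv) p.332 (PDF p.106); Def 4.1 (iii)(a) p.313 (PDF p.87)] -/
theorem chi_aug_eq_one_of_rho_eq_one
    (hi : ∀ x : 𝔉.EPiN, ((CycEnvelope.proj T.augY T.chi (i.e x) : T.PiY) : T.PiX) = ι (𝔉.toPiY x))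
    (y : 𝔉.PiYdd) (hρ : 𝔉.ρ (y : 𝔉.PiX) = 1) : T.chi (T.aug (ι (y : 𝔉.PiX))) = 1 := by
  ext a
  -- `μ(a) = i(u, 1)` for some `u ∈ μ_N(B_N)` (the isomorphism lies over `ι`, so `i⁻¹μ(a) ∈ Ker(E^Π_N ↠ Π^tp_Y̲) = μ_N(B_N)`)
  have hmem : i.e.symm (CycEnvelope.inMu T.augY T.chi a) ∈ 𝔉.muIncl.range := by
    rw [← 𝔉.toPiY_ker hsec]
    refine (MonoidHom.mem_ker (f := 𝔉.toPiY)).mpr ?_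
    apply ι.injective
    rw [map_one, ← hi, ContinuousMulEquiv.apply_symm_apply]
    simp
  obtain ⟨u, hu⟩ := hmem
  have hiu : i.e (𝔉.muIncl u) = CycEnvelope.inMu T.augY T.chi a := by
    rw [hu, ContinuousMulEquiv.apply_symm_apply]
  -- in `E^Π_N`, `s^⊓-Π_N(y) = (1, y)` commutes with `(u, 1)`
  have hfst : ((𝔉.sCapPi hsec y : 𝔉.EPiN) : Aut 𝔉.BN × 𝔉.PiX).1 = 1 := by
    change 𝔉.sgpCap (𝔉.ρ (y : 𝔉.PiX)) = 1
    rw [hρ, map_one]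
  have hconj : 𝔉.sCapPi hsec y * 𝔉.muIncl u * (𝔉.sCapPi hsec y)⁻¹ = 𝔉.muIncl u := by
    apply Subtype.ext
    apply Prod.ext
    · simp only [Subgroup.coe_mul, Subgroup.coe_inv, Prod.fst_mul, Prod.fst_inv, hfst, one_mul, inv_one, mul_one]
    · simp only [Subgroup.coe_mul, Subgroup.coe_inv, Prod.snd_mul, Prod.snd_inv, coe_muIncl, mul_one,
        mul_inv_cancel]
  -- transport by `i` and read the conjugation in `Π^tp_Y[μ_N]`
  have himg : i.e (𝔉.sCapPi hsec y) * CycEnvelope.inMu T.augY T.chi a * (i.e (𝔉.sCapPi hsec y))⁻¹ =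
      CycEnvelope.inMu T.augY T.chi a := by
    have h := congrArg i.e hconj
    have hm : i.e (𝔉.sCapPi hsec y * 𝔉.muIncl u * (𝔉.sCapPi hsec y)⁻¹) =
        i.e (𝔉.sCapPi hsec y) * i.e (𝔉.muIncl u) * (i.e (𝔉.sCapPi hsec y))⁻¹ := by
      rw [𝔉.biThetaIso_map_mul_inv h1 h3 hsec hcs h8 DK T hη i]
      exact congrArg (· * (i.e (𝔉.sCapPi hsec y))⁻¹)
        (map_mul i.e (𝔉.sCapPi hsec y : (𝔉.frdBiThetaEnv h1 h3 hsec hcs h8 DK).Pi)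
          (𝔉.muIncl u : (𝔉.frdBiThetaEnv h1 h3 hsec hcs h8 DK).Pi))
    rw [hm, hiu] at h
    exact h
  rw [CycEnvelope.conj_inMu_eq] at himg
  have ha := SemidirectProduct.inl_injective himg
  -- `aug(proj(i(s^⊓-Π_N(y)))) = aug(ι y)`
  have hpr : T.augY (i.e (𝔉.sCapPi hsec y)).right = T.aug (ι (y : 𝔉.PiX)) := by
    change T.aug ((CycEnvelope.proj T.augY T.chi (i.e (𝔉.sCapPi hsec y)) : T.PiY) : T.PiX) = _
    rw [hi, 𝔉.toPiY_sCapPi hsec]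
  rw [hpr] at ha
  rw [ha, MulAut.one_apply]

/-- `hD1` in abc-iut-L6-t23's shape, on `Π^tp_Ÿ`: `∀ k ∈ Π^tp_Ÿ, ρ(ι⁻¹ k) = 1 → χ(aug k) = 1`.
[cite: MochizukiEtTh2009, Lem 5.9 (iv) p.332 (PDF p.106); Def 4.1 (iii)(a) p.313 (PDF p.87)] -/
theorem chi_aug_eq_one_of_rho_symm_eq_one
    (hi : ∀ x : 𝔉.EPiN, ((CycEnvelope.proj T.augY T.chi (i.e x) : T.PiY) : T.PiX) = ι (𝔉.toPiY x))
    (hYdd : 𝔉.PiYdd.map ι.toMonoidHom = T.PiYdd) (k : T.PiYdd) (hk : 𝔉.ρ (ι.symm (k : T.PiX)) = 1) :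
    T.chi (T.aug (k : T.PiX)) = 1 := by
  have hkmem : (k : T.PiX) ∈ 𝔉.PiYdd.map ι.toMonoidHom := by rw [hYdd]; exact k.2
  obtain ⟨y, hy, hyk⟩ := hkmem
  have hys : ι.symm (k : T.PiX) = y := by rw [← hyk]; exact ι.symm_apply_apply y
  rw [hys] at hk
  have h := 𝔉.chi_aug_eq_one_of_rho_eq_one h1 h3 hsec hcs h8 DK T ι hη i hi ⟨y, hy⟩ hk
  rw [← hyk]
  exact h

/-- A coboundary vanishes where the character does: `χ(aug g) = 1 ⟹ δ_c(g) = c · c⁻¹ = 1`.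
[cite: MochizukiEtTh2009, p.47] -/
theorem _root_.Literature.AnabelianGeometry.EtaleTheta.CycEnvelope.coboundary_eq_one_of_chi_eq_one
    {P G μ : Type*} [Group P] [Group G] [CommGroup μ] (aug : P →* G) (χ : G →* MulAut μ) (c : μ) (g : P)
    (hg : χ (aug g) = 1) : CycEnvelope.coboundary aug χ c g = 1 := by
  simp [CycEnvelope.coboundary, hg]

/-- **`η` dies on `ι(Ker ρ ∩ Π^tp_Ÿ̲)` ON THE NOSE**: for `y ∈ Π^tp_Ÿ̲` with `ρ y = 1`, `η(ι y) = 1` — by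
`exists_coboundary_eta_eq_of_rho_eq_one` (`η = δ_d` there) and `chi_aug_eq_one_of_rho_eq_one` (`δ_d = 1` there).  No
hypothesis on `aug(ι y)` (cf. the `Δ`-version `biThetaIso_eta_eq_one_of_rho_eq_one` of `Sec5Rho219PinLaws`).
[cite: MochizukiEtTh2009, Lem 5.9 (iv)/(v) p.332 (PDF p.106); Prop 5.2 (iii) p.324 (PDF p.98)] -/
theorem eta_eq_one_of_rho_eq_one
    (hi : ∀ x : 𝔉.EPiN, ((CycEnvelope.proj T.augY T.chi (i.e x) : T.PiY) : T.PiX) = ι (𝔉.toPiY x))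
    (hYdd : 𝔉.PiYdd.map ι.toMonoidHom = T.PiYdd) (y : 𝔉.PiYdd) (hρ : 𝔉.ρ (y : 𝔉.PiX) = 1) :
    η ⟨ι (y : 𝔉.PiX), 𝔉.iota_mem_PiYdd T ι hYdd y⟩ = 1 := by
  obtain ⟨d, hd⟩ := 𝔉.exists_coboundary_eta_eq_of_rho_eq_one h1 h3 hsec hcs h8 DK T ι hη i hi hYdd
  rw [hd y hρ]
  exact CycEnvelope.coboundary_eq_one_of_chi_eq_one _ _ d _
    (𝔉.chi_aug_eq_one_of_rho_eq_one h1 h3 hsec hcs h8 DK T ι hη i hi y hρ)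

/-- **The binder `hdies` of abc-iut-w5-d123, VERBATIM, for the cocycle of the bi-theta isomorphism** (GAP G-w5d123-1
re-routed to Lemma 5.9 (iv)): `∀ k ∈ Π^tp_Ÿ, ρ(ι⁻¹ k) = 1 → η k = 1` — the hypothesis of
`ThetaEnvData.thetaCocycle_eq_of_map_eq` / `exists_descent_thetaCocycle` for `ρ ∘ ι⁻¹` and `η₀ := η`.
[cite: MochizukiEtTh2009, Lem 5.9 (iv)/(v) p.332 (PDF p.106); Prop 5.2 (iii) p.324 (PDF p.98)] -/
theorem hdies_of_biTheta
    (hi : ∀ x : 𝔉.EPiN, ((CycEnvelope.proj T.augY T.chi (i.e x) : T.PiY) : T.PiX) = ι (𝔉.toPiY x))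
    (hYdd : 𝔉.PiYdd.map ι.toMonoidHom = T.PiYdd) (k : T.PiYdd) (hk : 𝔉.ρ (ι.symm (k : T.PiX)) = 1) :
    η k = 1 := by
  have hkmem : (k : T.PiX) ∈ 𝔉.PiYdd.map ι.toMonoidHom := by rw [hYdd]; exact k.2
  obtain ⟨y, hy, hyk⟩ := hkmem
  have hys : ι.symm (k : T.PiX) = y := by rw [← hyk]; exact ι.symm_apply_apply y
  rw [hys] at hk
  have hk' : k = ⟨ι ((⟨y, hy⟩ : 𝔉.PiYdd) : 𝔉.PiX), 𝔉.iota_mem_PiYdd T ι hYdd ⟨y, hy⟩⟩ := Subtype.ext hyk.symm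
  rw [hk']
  exact 𝔉.eta_eq_one_of_rho_eq_one h1 h3 hsec hcs h8 DK T ι hη i hi hYdd ⟨y, hy⟩ hk

/-- **Fibre-constancy for free**: with the bi-theta isomorphism, `η` is constant on the fibres of `ρ ∘ ι⁻¹` on
`Π^tp_Ÿ` (w5-d123's `thetaCocycle_eq_of_map_eq` with its `hdies` DISCHARGED by `hdies_of_biTheta`).
[cite: MochizukiEtTh2009, Prop 5.2 (iii) p.324 (PDF p.98); Lem 5.9 (v) p.332 (PDF p.106)] -/
theorem eta_eq_of_rho_symm_eq
    (hi : ∀ x : 𝔉.EPiN, ((CycEnvelope.proj T.augY T.chi (i.e x) : T.PiY) : T.PiX) = ι (𝔉.toPiY x))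
    (hYdd : 𝔉.PiYdd.map ι.toMonoidHom = T.PiYdd) (k₁ k₂ : T.PiYdd)
    (h : 𝔉.ρ (ι.symm (k₁ : T.PiX)) = 𝔉.ρ (ι.symm (k₂ : T.PiX))) : η k₁ = η k₂ := by
  have hb : 𝔉.ρ (ι.symm ((k₁⁻¹ * k₂ : T.PiYdd) : T.PiX)) = 1 := by
    rw [Subgroup.coe_mul, Subgroup.coe_inv, map_mul, map_inv, map_mul, map_inv, h, inv_mul_cancel]
  have hlaw := T.isCocycle η hη k₁ (k₁⁻¹ * k₂)
  rw [mul_inv_cancel_left, 𝔉.hdies_of_biTheta h1 h3 hsec hcs h8 DK T ι hη i hi hYdd _ hb, map_one, mul_one] at hlaw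
  exact hlaw.symm

/-! ## BY NAME: from L2-t4's `EnvIsoBiTheta` (Lemma 5.9 (iv) as typed)

(appended, abc-iut-w4-d042 gen 2.)  The same conclusions with the isomorphism extracted by choice from the named fact
`EnvIsoBiTheta h1 h3 hsec hcs h8 DK T ι` — the form the GAP-LEDGER rows cite. -/

/-- **`EnvIsoBiTheta ⟹ hD1`** (cocycle-free): Lemma 5.9 (iv) as typed by abc-iut-L2-t4 implies that `Ker(ρ ∘ ι⁻¹) ∩ Π^tp_Ÿ`
acts trivially on `μ_N` (abc-iut-L6-t23's binder `hD1`, GAP G-L6t23-1, for `ρ ∘ ι⁻¹`).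
[cite: MochizukiEtTh2009, Lem 5.9 (iv) p.332 (PDF p.106); Def 4.1 (iii)(a) p.313 (PDF p.87)] -/
theorem chi_aug_eq_one_of_envIsoBiTheta {T : ThetaEnvData.{v} 𝔉.N} {ι : 𝔉.PiX ≃ₜ* T.PiX}
    (h59iv : 𝔉.EnvIsoBiTheta h1 h3 hsec hcs h8 DK T ι) (k : T.PiYdd) (hk : 𝔉.ρ (ι.symm (k : T.PiX)) = 1) :
    T.chi (T.aug (k : T.PiX)) = 1 := by
  obtain ⟨-, hYdd, η, hη, i, hi, -⟩ := h59iv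
  exact 𝔉.chi_aug_eq_one_of_rho_symm_eq_one h1 h3 hsec hcs h8 DK T ι hη i hi hYdd k hk

/-- **`EnvIsoBiTheta ⟹ hdies` for some cocycle of the collection**: Lemma 5.9 (iv) as typed implies that SOME theta
cocycle `η ∈ T.thetaCocycles` (the one carrying the isomorphism) dies on `ι(Ker ρ ∩ Π^tp_Ÿ̲)` — abc-iut-w5-d123's binder
`hdies` (GAP G-w5d123-1) for `ρ ∘ ι⁻¹`, in the form consumed by `exists_eta_etaTautological_ofBiKummerData`-type closers
(which take ANY cocycle of the collection). [cite: MochizukiEtTh2009, Lem 5.9 (iv)/(v) p.332 (PDF p.106); Prop 5.2 (iii) p.324 (PDF p.98)] -/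
theorem exists_hdies_of_envIsoBiTheta {T : ThetaEnvData.{v} 𝔉.N} {ι : 𝔉.PiX ≃ₜ* T.PiX}
    (h59iv : 𝔉.EnvIsoBiTheta h1 h3 hsec hcs h8 DK T ι) :
    ∃ η ∈ T.thetaCocycles, ∀ k : T.PiYdd, 𝔉.ρ (ι.symm (k : T.PiX)) = 1 → η k = 1 := by
  obtain ⟨-, hYdd, η, hη, i, hi, -⟩ := h59iv
  exact ⟨η, hη, fun k hk => 𝔉.hdies_of_biTheta h1 h3 hsec hcs h8 DK T ι hη i hi hYdd k hk⟩

/-- **`EnvIsoBiTheta ⟹` the cocycle OF THE ISOMORPHISM dies** (the choice-extracted cocycle `h59iv.2.2.choose` used by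
`Sec5Rho219Pin.cycRigidityCoincide_rho219_of_envIsoBiTheta`). [cite: MochizukiEtTh2009, Lem 5.9 (iv)/(v) p.332 (PDF p.106)] -/
theorem hdies_choose_of_envIsoBiTheta {T : ThetaEnvData.{v} 𝔉.N} {ι : 𝔉.PiX ≃ₜ* T.PiX}
    (h59iv : 𝔉.EnvIsoBiTheta h1 h3 hsec hcs h8 DK T ι) (k : T.PiYdd) (hk : 𝔉.ρ (ι.symm (k : T.PiX)) = 1) :
    h59iv.2.2.choose k = 1 :=
  𝔉.hdies_of_biTheta h1 h3 hsec hcs h8 DK T ι h59iv.2.2.choose_spec.choose h59iv.2.2.choose_spec.choose_spec.choose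
    h59iv.2.2.choose_spec.choose_spec.choose_spec.1 h59iv.2.1 k hk

end ThetaFrobenioid

end Literature.AnabelianGeometry.EtaleTheta

end
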